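import Mathlib.Algebra.MvPolynomial.CommRing
import Mathlib.Algebra.MvPolynomial.Nilpotent
import Mathlib.RingTheory.MvPolynomial.Ideal
import Mathlib.RingTheory.Ideal.Maps
import Mathlib.RingTheory.Ideal.Quotient.Operations
import Mathlib.RingTheory.PrincipalIdealDomain
import Mathlib.Tactic.FinCases
import Mathlib.Tactic.LinearCombination
import Mathlib.Tactic.Ring
import HarnessLib

/-!
# Junction lemma J1 (transversal type `A₁`), part 1: the ideal of `Σ ∪ R` on `{στ = 0} × 𝔸¹` and its traces

[OURS · L1 W4.5(b)] Helper for the research stub `stub_elnat_three` of the crux `EquisingularLiftNat`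
(stmt-ResolutionOfSingularities-20038; route `EquisingularLift`, chain w45b, CRUX-PLAN v3 §1.6 «NO-DAMAGE
(J1)» / §4 `junction_transversal_A1_noDamage`). NOT a statement of any manuscript; AI-written kernel
lemma of the cell `res-hironaka` (weaker than expert review). Part 2 (`…NatJunctionTransversal.lean`)
computes the blow-up of `H` along `X`; this file supplies the ideal-theoretic facts. The companion
file for the cuspidal transversal type is `…NatJunctionCusp{Ideal,}.lean` (J2).

**The model** (CRUX-PLAN v3 §1.6: «(J1) `H = {στ = 0} × w`, `Σ = {σ = τ = 0}`, `R = {σ = 0 = w} ⊂ S₁`: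
`𝓘_X = (σ, τw)`; `𝓘_X·𝒪_{S₁} = (τw)`, `𝓘_X·𝒪_{S₂} = (σ)` — both principal»). `R` any commutative
ring (a field `k` for the non-principality statement); `R[σ, τ, w] = MvPolynomial (Fin 3) R` with
`σ = X 0`, `τ = X 1`, `w = X 2`; `H = {στ = 0}` (two transversal sheets `S₁ = {σ = 0}`, `S₂ = {τ = 0}`
with double line `Σ = {σ = τ = 0}`); the single-sheet companion `R = {σ = w = 0} ⊂ S₁`; `X = Σ ∪ R`.

**Proved here** (objects pinned by equational hypotheses, no definitions):
* `span_inf_span_eq_transversal` — `I_X = (σ, τ) ∩ (σ, w) = (σ, τw)`;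
* `map_junctionIdeal_sheet_one` / `_two` — the traces `I_X·𝒪_{S₁} = (τ̄w̄)` and `I_X·𝒪_{S₂} = (σ̄)`
  are principal (so `Bl_X` is an isomorphism on each sheet);
* `traceIdeal_transversal_not_isPrincipal` — over a field, the trace `I_X·𝒪_H = (σ̄, τ̄w̄)` on
  `𝒪_H = k[σ,τ,w]/(στ)` is NOT principal (the centre `X` is useful on `H`);
* tools: `mem_span_X_of_X_mul_mem` / `_pow_` (saturation of the monomial ideal `(X i)` with
  respect to another variable, via supports), `constantCoeff_aeval_eq`.

What is NOT here: power-series versions (flat base change); the ambient blow-up `Bl_X 𝔸³` and its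
conifold point (CRUX-PLAN: «lies on `St S₂`, where `H_{i+1}` is regular ⇒ harmless») — part 2 shows
`Bl_X H` is the disjoint union of the two (regular) sheets, which is what «no damage» needs.
References: folklore commutative algebra; the plan's hand computation CRUX-PLAN v3 §1.6 (cell-internal).
-/

-- single-problem summit: the doubled namespace component `ResolutionOfSingularities` is forced
set_option linter.dupNamespace false

noncomputable section

open MvPolynomial

namespace Summit.ResolutionOfSingularities.ResolutionOfSingularities.Theorems.EquisingularLift.Junction

universe u

section IdealOfX

variable {R : Type u} [CommRing R]

/-- Saturation of the monomial ideal `(X i)` of `R[X 0, X 1, X 2]` with respect to another variable: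
`X j · x ∈ (X i)`, `j ≠ i`, implies `x ∈ (X i)`. [folklore] -/
theorem mem_span_X_of_X_mul_mem {i j : Fin 3} (hij : j ≠ i) {x : MvPolynomial (Fin 3) R}
    (h : X j * x ∈ Ideal.span ({X i} : Set (MvPolynomial (Fin 3) R))) :
    x ∈ Ideal.span ({X i} : Set (MvPolynomial (Fin 3) R)) := by
  have hset : ({X i} : Set (MvPolynomial (Fin 3) R)) = X '' {i} := by simp
  rw [hset, mem_ideal_span_X_image] at h ⊢
  intro m hm
  have hm' : Finsupp.single j 1 + m ∈ (X j * x).support := by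
    rw [support_X_mul]
    exact Finset.mem_map_of_mem _ hm
  obtain ⟨i', hi', hmi⟩ := h _ hm'
  simp only [Set.mem_singleton_iff] at hi'
  subst hi'
  refine ⟨i', rfl, ?_⟩
  simpa [Finsupp.single_apply, hij] using hmi

/-- Iterated saturation: `X j ^ n · x ∈ (X i)`, `j ≠ i`, implies `x ∈ (X i)`. [folklore] -/
theorem mem_span_X_of_X_pow_mul_mem {i j : Fin 3} (hij : j ≠ i) :
    ∀ (n : ℕ) {x : MvPolynomial (Fin 3) R},
      X j ^ n * x ∈ Ideal.span ({X i} : Set (MvPolynomial (Fin 3) R)) →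
      x ∈ Ideal.span ({X i} : Set (MvPolynomial (Fin 3) R))
  | 0, x, h => by simpa using h
  | n + 1, x, h => by
    have h' : X j ^ n * (X j * x) ∈ Ideal.span ({X i} : Set (MvPolynomial (Fin 3) R)) := by
      rw [← mul_assoc, ← pow_succ]; exact h
    exact mem_span_X_of_X_mul_mem hij (mem_span_X_of_X_pow_mul_mem hij n h')

/-- **The ideal of `X = Σ ∪ R` (transversal type `A₁`).** In `R[σ, τ, w]` (`σ = X 0`, `τ = X 1`,
`w = X 2`): the intersection of the ideal `(σ, τ)` of the double line `Σ` of `H = {στ = 0}` with the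
ideal `(σ, w)` of the companion line `R = {σ = w = 0}` inside the sheet `S₁ = {σ = 0}` is `(σ, τw)`.
[folklore] -/
theorem span_inf_span_eq_transversal :
    Ideal.span ({X 0, X 1} : Set (MvPolynomial (Fin 3) R)) ⊓ Ideal.span {X 0, X 2} =
      Ideal.span {X 0, X 1 * X 2} := by
  apply le_antisymm
  · intro f hf
    obtain ⟨hf1, hf2⟩ := Submodule.mem_inf.mp hf
    obtain ⟨γ, δ, rfl⟩ := Ideal.mem_span_pair.mp hf2
    -- `δ w ∈ (σ, τ)`, hence `δ ∈ (σ, τ)` (kill `σ`, then saturate `(τ)` with respect to `w`)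
    have hδw : δ * X 2 ∈ Ideal.span ({X 0, X 1} : Set (MvPolynomial (Fin 3) R)) := by
      have := Ideal.sub_mem _ hf1 (Ideal.mul_mem_left _ γ (Ideal.subset_span (by simp) :
        (X 0 : MvPolynomial (Fin 3) R) ∈ Ideal.span ({X 0, X 1} : Set (MvPolynomial (Fin 3) R))))
      rwa [add_sub_cancel_left] at this
    -- the monomial ideal `(σ, τ) = (X '' {0, 1})` is saturated with respect to `w`: test on supports
    have hset : ({X 0, X 1} : Set (MvPolynomial (Fin 3) R)) = X '' {0, 1} := by
      simp [Set.image_insert_eq]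
    have hδ' : δ ∈ Ideal.span ({X 0, X 1} : Set (MvPolynomial (Fin 3) R)) := by
      rw [hset, mem_ideal_span_X_image] at hδw ⊢
      intro m hm
      have hm' : m + Finsupp.single 2 1 ∈ (δ * X 2).support := by
        rw [support_mul_X]; exact Finset.mem_map_of_mem _ hm
      obtain ⟨i, hi, hmi⟩ := hδw _ hm'
      refine ⟨i, hi, ?_⟩
      simp only [Set.mem_insert_iff, Set.mem_singleton_iff] at hi
      rcases hi with rfl | rfl <;> simpa using hmi
    obtain ⟨δ₁, δ₂, hδ⟩ := Ideal.mem_span_pair.mp hδ'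
    rw [← hδ]
    have e : γ * X 0 + (δ₁ * X 0 + δ₂ * X 1) * X 2 =
        (γ + δ₁ * X 2) * X 0 + δ₂ * (X 1 * X 2) := by ring
    rw [e]
    exact Ideal.add_mem _ (Ideal.mul_mem_left _ _ (Ideal.subset_span (by simp)))
      (Ideal.mul_mem_left _ _ (Ideal.subset_span (by simp)))
  · rw [Ideal.span_le]
    intro f hf
    simp only [Set.mem_insert_iff, Set.mem_singleton_iff] at hf
    rcases hf with rfl | rfl
    · exact Submodule.mem_inf.mpr ⟨Ideal.subset_span (by simp), Ideal.subset_span (by simp)⟩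
    · exact Submodule.mem_inf.mpr ⟨Ideal.mul_mem_right _ _ (Ideal.subset_span (by simp)),
        Ideal.mul_mem_left _ _ (Ideal.subset_span (by simp))⟩

/-- **Trace on the sheet `S₁ = {σ = 0}`**: `I_X · 𝒪_{S₁} = (τw)` is principal. [folklore] -/
theorem map_junctionIdeal_sheet_one :
    (Ideal.span ({X 0, X 1 * X 2} : Set (MvPolynomial (Fin 3) R))).map
        (Ideal.Quotient.mk (Ideal.span {(X 0 : MvPolynomial (Fin 3) R)})) =
      Ideal.span {Ideal.Quotient.mk (Ideal.span {(X 0 : MvPolynomial (Fin 3) R)}) (X 1 * X 2)} := by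
  rw [Ideal.map_span, Set.image_insert_eq, Set.image_singleton,
    Ideal.Quotient.eq_zero_iff_mem.mpr (Ideal.mem_span_singleton_self _)]
  apply le_antisymm
  · rw [Ideal.span_le]
    rintro x hx
    simp only [Set.mem_insert_iff, Set.mem_singleton_iff] at hx
    rcases hx with rfl | rfl
    · exact Ideal.zero_mem _
    · exact Ideal.mem_span_singleton_self _
  · exact Ideal.span_mono (Set.subset_insert _ _)

/-- **Trace on the sheet `S₂ = {τ = 0}`**: `I_X · 𝒪_{S₂} = (σ)` is principal. [folklore] -/
theorem map_junctionIdeal_sheet_two :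
    (Ideal.span ({X 0, X 1 * X 2} : Set (MvPolynomial (Fin 3) R))).map
        (Ideal.Quotient.mk (Ideal.span {(X 1 : MvPolynomial (Fin 3) R)})) =
      Ideal.span {Ideal.Quotient.mk (Ideal.span {(X 1 : MvPolynomial (Fin 3) R)}) (X 0)} := by
  have h0 : Ideal.Quotient.mk (Ideal.span {(X 1 : MvPolynomial (Fin 3) R)}) (X 1 * X 2) = 0 :=
    Ideal.Quotient.eq_zero_iff_mem.mpr (Ideal.mul_mem_right _ _ (Ideal.mem_span_singleton_self _))
  rw [Ideal.map_span, Set.image_insert_eq, Set.image_singleton, h0]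
  apply le_antisymm
  · rw [Ideal.span_le]
    rintro x hx
    simp only [Set.mem_insert_iff, Set.mem_singleton_iff] at hx
    rcases hx with rfl | rfl
    · exact Ideal.mem_span_singleton_self _
    · exact Ideal.zero_mem _
  · exact Ideal.span_mono (Set.singleton_subset_iff.mpr (Set.mem_insert _ _))

end IdealOfX

/-! ## The trace `I_X · 𝒪_H` on `H = {στ = 0}` is not principal -/

section Field

variable {k : Type u} [Field k]

/-- Substitutions that send every variable to `0` or to a variable do not change the constant
coefficient. [folklore] -/
theorem constantCoeff_aeval_eq {f : Fin 3 → MvPolynomial (Fin 3) k}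
    (hf : ∀ i, constantCoeff (f i) = 0) (p : MvPolynomial (Fin 3) k) :
    constantCoeff (aeval f p) = constantCoeff p := by
  induction p using MvPolynomial.induction_on with
  | C c => simp
  | add p q hp hq => simp only [map_add, hp, hq]
  | mul_X p i hp => simp only [map_mul, aeval_X, hf, hp, constantCoeff_X, mul_zero]

/-- **`I_X · 𝒪_H` is not principal** for `H = {στ = 0}`, `X = Σ ∪ R`, `I_X = (σ, τw)`: the centre is
useful (two generators are needed at the origin). Proof by the two substitutions `τ ↦ 0` and `σ ↦ 0`:
a generator `h` would give `a h ≡ σ`, forcing the constant term of `a` to be non-zero (on `τ = 0`)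
and zero (on `σ = 0`, where `h` becomes a unit multiple of `τw ≠ 0`). [folklore] -/
theorem traceIdeal_transversal_not_isPrincipal
    (I : Ideal (MvPolynomial (Fin 3) k ⧸ Ideal.span {(X 0 * X 1 : MvPolynomial (Fin 3) k)}))
    (hI : I = Ideal.span {Ideal.Quotient.mk _ (X 0), Ideal.Quotient.mk _ (X 1 * X 2)}) :
    ¬ I.IsPrincipal := by
  rintro ⟨h', hh⟩
  rw [Ideal.submodule_span_eq] at hh
  subst hI
  obtain ⟨h, rfl⟩ := Ideal.Quotient.mk_surjective h'
  -- lifting equalities in the quotient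
  have lift : ∀ x y : MvPolynomial (Fin 3) k,
      Ideal.Quotient.mk (Ideal.span {(X 0 * X 1 : MvPolynomial (Fin 3) k)}) x =
        Ideal.Quotient.mk (Ideal.span {(X 0 * X 1 : MvPolynomial (Fin 3) k)}) y →
      ∃ c, c * (X 0 * X 1) = x - y := fun x y hxy =>
    Ideal.mem_span_singleton'.mp ((Ideal.Quotient.mk_eq_mk_iff_sub_mem _ _).mp hxy)
  -- (i) `σ̄ ∈ (h̄)`: `a h = σ + c στ`
  have hσ : Ideal.Quotient.mk (Ideal.span {(X 0 * X 1 : MvPolynomial (Fin 3) k)}) (X 0) ∈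
      Ideal.span {Ideal.Quotient.mk (Ideal.span {(X 0 * X 1 : MvPolynomial (Fin 3) k)}) h} := by
    rw [← hh]; exact Ideal.subset_span (by simp)
  obtain ⟨a', ha'⟩ := Ideal.mem_span_singleton'.mp hσ
  obtain ⟨a, rfl⟩ := Ideal.Quotient.mk_surjective a'
  rw [← map_mul] at ha'
  obtain ⟨c, hc⟩ := lift _ _ ha'
  -- (ii) `τ̄w̄ ∈ (h̄)`: `a₂ h = τw + c₂ στ`
  have hτw : Ideal.Quotient.mk (Ideal.span {(X 0 * X 1 : MvPolynomial (Fin 3) k)}) (X 1 * X 2) ∈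
      Ideal.span {Ideal.Quotient.mk (Ideal.span {(X 0 * X 1 : MvPolynomial (Fin 3) k)}) h} := by
    rw [← hh]; exact Ideal.subset_span (by simp)
  obtain ⟨a₂', ha₂'⟩ := Ideal.mem_span_singleton'.mp hτw
  obtain ⟨a₂, rfl⟩ := Ideal.Quotient.mk_surjective a₂'
  rw [← map_mul] at ha₂'
  obtain ⟨c₂, hc₂⟩ := lift _ _ ha₂'
  -- (iii) `h̄ ∈ (σ̄, τ̄w̄)`: `h = d σ + e τw + c₃ στ`
  have hhI : Ideal.Quotient.mk (Ideal.span {(X 0 * X 1 : MvPolynomial (Fin 3) k)}) h ∈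
      Ideal.span {Ideal.Quotient.mk (Ideal.span {(X 0 * X 1 : MvPolynomial (Fin 3) k)}) (X 0),
        Ideal.Quotient.mk (Ideal.span {(X 0 * X 1 : MvPolynomial (Fin 3) k)}) (X 1 * X 2)} := by
    rw [hh]; exact Ideal.mem_span_singleton_self _
  obtain ⟨d', e', hde⟩ := Ideal.mem_span_pair.mp hhI
  obtain ⟨d, rfl⟩ := Ideal.Quotient.mk_surjective d'
  obtain ⟨e, rfl⟩ := Ideal.Quotient.mk_surjective e'
  rw [← map_mul, ← map_mul, ← map_add] at hde
  obtain ⟨c₃, hc₃⟩ := lift _ _ hde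
  -- the two substitutions
  let ρ₁ : MvPolynomial (Fin 3) k →ₐ[k] MvPolynomial (Fin 3) k := aeval ![0, X 1, X 2]
  let ρ₂ : MvPolynomial (Fin 3) k →ₐ[k] MvPolynomial (Fin 3) k := aeval ![X 0, 0, X 2]
  have hρ₁ : ρ₁ (X 0) = 0 ∧ ρ₁ (X 1) = X 1 ∧ ρ₁ (X 2) = X 2 := by
    refine ⟨?_, ?_, ?_⟩ <;> simp [ρ₁]
  have hρ₂ : ρ₂ (X 0) = X 0 ∧ ρ₂ (X 1) = 0 ∧ ρ₂ (X 2) = X 2 := by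
    refine ⟨?_, ?_, ?_⟩ <;> simp [ρ₂]
  have hcc₁ : ∀ p, constantCoeff (ρ₁ p) = constantCoeff p :=
    constantCoeff_aeval_eq (fun i => by fin_cases i <;> simp)
  have hcc₂ : ∀ p, constantCoeff (ρ₂ p) = constantCoeff p :=
    constantCoeff_aeval_eq (fun i => by fin_cases i <;> simp)
  have hc' : a * h = X 0 + c * (X 0 * X 1) := by rw [hc]; ring
  have hc₂' : a₂ * h = X 1 * X 2 + c₂ * (X 0 * X 1) := by rw [hc₂]; ring
  have hc₃' : h = d * X 0 + e * (X 1 * X 2) - c₃ * (X 0 * X 1) := by rw [hc₃]; ring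
  -- on `τ = 0`: `ρ₂(a) ρ₂(d) = 1`, so the constant term of `a` is non-zero
  have e2h : ρ₂ h = ρ₂ d * X 0 := by
    have := congrArg ρ₂ hc₃'
    simp only [map_add, map_sub, map_mul, hρ₂.1, hρ₂.2.1, hρ₂.2.2, mul_zero, zero_mul,
      sub_zero, add_zero] at this
    exact this
  have e2 : ρ₂ a * ρ₂ d = 1 := by
    have := congrArg ρ₂ hc'
    simp only [map_add, map_mul, hρ₂.1, hρ₂.2.1, mul_zero, add_zero, e2h] at this
    -- `ρ₂ a * (ρ₂ d * X 0) = X 0`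
    have h0 : (X 0 : MvPolynomial (Fin 3) k) * (ρ₂ a * ρ₂ d - 1) = 0 := by
      linear_combination this
    rcases mul_eq_zero.mp h0 with h0 | h0
    · exact absurd h0 (X_ne_zero _)
    · exact sub_eq_zero.mp h0
  have hca : constantCoeff a ≠ 0 := by
    intro h0
    have := congrArg constantCoeff e2
    rw [map_mul, hcc₂, h0, zero_mul, map_one] at this
    exact zero_ne_one this
  -- on `σ = 0`: `ρ₁(h) = ρ₁(e) τ w` is a unit multiple of `τw`, and `ρ₁(a) ρ₁(h) = 0`
  have e1h : ρ₁ h = ρ₁ e * (X 1 * X 2) := by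
    have := congrArg ρ₁ hc₃'
    simp only [map_add, map_sub, map_mul, hρ₁.1, hρ₁.2.1, hρ₁.2.2, mul_zero, zero_mul,
      sub_zero, zero_add] at this
    exact this
  have e1 : ρ₁ a₂ * ρ₁ e = 1 := by
    have := congrArg ρ₁ hc₂'
    simp only [map_add, map_mul, hρ₁.1, hρ₁.2.1, hρ₁.2.2, mul_zero, zero_mul, add_zero,
      e1h] at this
    have h0 : (X 1 * X 2 : MvPolynomial (Fin 3) k) * (ρ₁ a₂ * ρ₁ e - 1) = 0 := by
      linear_combination this
    rcases mul_eq_zero.mp h0 with h0 | h0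
    · exact absurd h0 (mul_ne_zero (X_ne_zero _) (X_ne_zero _))
    · exact sub_eq_zero.mp h0
  have e1a : ρ₁ a = 0 := by
    have h0 := congrArg ρ₁ hc'
    simp only [map_add, map_mul, hρ₁.1, hρ₁.2.1, mul_zero, zero_mul, add_zero, e1h] at h0
    -- `ρ₁ a * (ρ₁ e * (τ w)) = 0` with `ρ₁ e` a unit
    have hu : IsUnit (ρ₁ e) := IsUnit.of_mul_eq_one _ (by rw [mul_comm]; exact e1)
    rcases mul_eq_zero.mp h0 with h0 | h0
    · exact h0
    · rcases mul_eq_zero.mp h0 with h1 | h1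
      · exact absurd h1 hu.ne_zero
      · exact absurd h1 (mul_ne_zero (X_ne_zero _) (X_ne_zero _))
  apply hca
  rw [← hcc₁, e1a, map_zero]

end Field
end Summit.ResolutionOfSingularities.ResolutionOfSingularities.Theorems.EquisingularLift.Junction

end
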